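import Literature.NumberTheory.Transcendental.AndreCriterionLinearAlgebraProofs
import Literature.NumberTheory.Transcendental.AndreCriterionAnalyticProofs
import Mathlib.Analysis.Normed.Group.Bounded
import Mathlib.Algebra.Order.Archimedean.Basic
import HarnessLib

/-!
# André's algebraicity criterion over `ℚ`, III: the criterion (Chambert-Loir, Sém. Bourbaki 886,
# Thm. 6.2 for `K = ℚ`; proofs only)

Topic `Literature/NumberTheory/Transcendental`. Third file, assembling the two halves already in
the tree (`AndreCriterionLinearAlgebraProofs`: the determinant inequality
`1 ≤ Πⱼ Den(nⱼ) · Πⱼ β(nⱼ)` over a jump sequence `n₀ < n₁ < ⋯ < n_{N-1}`;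
`AndreCriterionAnalyticProofs`: the Schwarz-lemma bound `β(n) = √N M^{d+D} r⁻ⁿ` from a
simultaneous uniformisation) into **André's algebraicity criterion over `ℚ`**
(`exists_relation_of_den_of_uniformization`), in the elementary form consumed by Bost's proof of
the isogeny theorem for elliptic curves over `ℚ` (the tree's
`WeierstrassCurve.isIsogenous_iff_frobeniusTrace_eq_of_andreCriterion`, whose hypothesis is
literally this statement):

> Let `y ∈ ℚ⟦x⟧` and `Den : ℕ → ℕ`, `0 < Den n ≤ Cⁿ`, with `Den n · [xᵐ](yʲ) ∈ ℤ` for `m ≤ n`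
> ("`τ(y) ≤ log C`"). Let `g, F, G` be holomorphic on `|z| < R` with `R > C`, `g(0) = 1`, and
> `φ, ψ` analytic germs at `0` with `F = gφ`, `G = gψ` near `0`, `φ(0) = 0`, `φ'(0) = 1`, and
> `y(φ̂) = ψ̂` (simultaneous uniformisation of `(x, y)` on `D(0, R)`). Then there is a non-trivial
> relation `Σ_{a ≤ d, b ≤ D} c_{ab} xᵃ yᵇ = 0` with `c_{ab} ∈ ℚ`.

Proof (Chambert-Loir §6.3–6.8 for `K = ℚ`): if not, for every `(d, D)` the rows
`w_m = ([xᵐ] xᵃ yᵇ)_{a ≤ d, b ≤ D} ∈ ℚ^N` separate points (`separating_of_rational`), have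
denominators `Den m`, and satisfy `|⟨w_m, v⟩| ≤ √N M^{d+D} r⁻ᵐ ‖v‖` on the vectors killed by
the earlier rows (`norm_coeff_le_of_coeff_lt_eq_zero` with `P = v` and Cauchy–Schwarz
`Σ|v_{ab}| ≤ √N ‖v‖`), any `C < r < R`, `M` a bound for `g, F, G` on `|z| = r`. The determinant
inequality then gives `1 ≤ Π Den(nⱼ) Π β(nⱼ) ≤ (√N M^{d+D})^N (C/r)^{Σnⱼ}` with
`Σ nⱼ ≥ N(N-1)/2`; for `d = D = 2k`, `N = (2k+1)²`, this is `1 ≤ ((2k+1)(M²(C/r)^{k+1})^{2k})^N`,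
absurd once `M²(C/r)^{k+1} ≤ 1/4` (`(2k+1) < 16ᵏ`).

## References

* A. Chambert-Loir, *Théorèmes d'algébricité en géométrie diophantienne (d'après J.-B. Bost,
  Y. André, D. & G. Chudnovsky)*, Sém. Bourbaki 886, Astérisque 282 (2002), Thm. 6.2, §6.3–6.8.
  [ChambertLoir2002Bourbaki]
* Y. André, *Sur la conjecture des `p`-courbures de Grothendieck–Katz et un problème de Dwork*
  (2004), Thm. 2.3.1. [Andre2004pCourbures]
* J.-B. Bost, Publ. Math. IHÉS 93 (2001), Thm. 2.1, §2.2, Cor. 2.5. [Bost2001AlgebraicLeaves]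
-/

noncomputable section

open PowerSeries Filter Metric Finset
open scoped Topology Nat RealInnerProductSpace

/-- The Taylor series of `f : ℂ → ℂ` at `0` (local notation, as in part II). -/
local notation3 "𝓣[" f "]" =>
  (PowerSeries.mk fun n => ((Nat.factorial n : ℂ)⁻¹ * iteratedDeriv n f 0) : PowerSeries ℂ)

namespace Literature.NumberTheory.Transcendental.AndreCriterion

/-! ### Elementary lemmas -/

/-- `[xᵐ](Σ c_{ab} xᵃ yᵇ) = Σ c_{ab} · [xᵐ⁻ᵃ](yᵇ)` (terms with `a > m` absent). [folklore] -/
theorem coeff_sum_C_mul_X_pow_mul_pow {A : Type*} [CommRing A] {ι : Type*} (s : Finset ι)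
    (c : ι → A) (ea eb : ι → ℕ) (y : A⟦X⟧) (m : ℕ) :
    coeff m (∑ i ∈ s, C (c i) * (X ^ ea i * y ^ eb i)) =
      ∑ i ∈ s, c i * (if ea i ≤ m then coeff (m - ea i) (y ^ eb i) else 0) := by
  rw [map_sum]
  refine Finset.sum_congr rfl fun i _ => ?_
  rw [coeff_C_mul, coeff_X_pow_mul']

/-- `Σᵢ |vᵢ| ≤ √N · ‖v‖` in `ℝ^N` (Cauchy–Schwarz against the all-ones vector). [folklore] -/
theorem sum_abs_le_sqrt_card_mul_norm {ι : Type*} [Fintype ι] (v : EuclideanSpace ℝ ι) :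
    ∑ i, |v i| ≤ Real.sqrt (Fintype.card ι) * ‖v‖ := by
  set a : EuclideanSpace ℝ ι := WithLp.toLp 2 fun i => |v i| with ha
  set e : EuclideanSpace ℝ ι := WithLp.toLp 2 fun _ => (1 : ℝ) with he
  have hinner : ⟪a, e⟫ = ∑ i, |v i| := by
    rw [PiLp.inner_apply]
    refine Finset.sum_congr rfl fun i _ => ?_
    simp [ha, he]
  have hna : ‖a‖ = ‖v‖ := by
    rw [EuclideanSpace.norm_eq, EuclideanSpace.norm_eq]
    congr 1
    refine Finset.sum_congr rfl fun i _ => ?_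
    simp [ha]
  have hne : ‖e‖ = Real.sqrt (Fintype.card ι) := by
    rw [EuclideanSpace.norm_eq]
    congr 1
    simp [he]
  calc ∑ i, |v i| = ⟪a, e⟫ := hinner.symm
    _ ≤ ‖a‖ * ‖e‖ := real_inner_le_norm _ _
    _ = Real.sqrt (Fintype.card ι) * ‖v‖ := by rw [hna, hne, mul_comm]

/-- `2k + 1 < 16ᵏ` for `k ≥ 1`. [folklore] -/
theorem two_mul_add_one_lt_sixteen_pow {k : ℕ} (hk : 1 ≤ k) : 2 * k + 1 < 16 ^ k := by
  have h1 : 2 * k + 1 < 2 ^ (2 * k + 1) := Nat.lt_two_pow_self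
  have h2 : 2 ^ (2 * k + 1) ≤ 2 ^ (4 * k) := Nat.pow_le_pow_right (by norm_num) (by omega)
  have h3 : 2 ^ (4 * k) = 16 ^ k := by rw [pow_mul]; norm_num
  omega

/-- The Gauss sum over `Fin N`: `Σ_{j < N} j = N(N-1)/2`, in the form `2Σj = N(N-1)`. [folklore] -/
theorem two_mul_sum_fin_val (N : ℕ) : 2 * ∑ j : Fin N, (j : ℕ) = N * (N - 1) := by
  rw [Fin.sum_univ_eq_sum_range (fun j => j) N, mul_comm, Finset.sum_range_id_mul_two]

/-! ### The criterion -/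

/-- **André's algebraicity criterion over `ℚ`** (Chambert-Loir, Sém. Bourbaki 886, Thm. 6.2,
first part, for `K = ℚ`, with the `p`-adic size condition `τ(y) ≤ log C` expressed by integer row
denominators `Den m ≤ Cᵐ`, and the archimedean uniformisation on `D(0, R)`, `R > C`, in
pole-cleared form `(φ, ψ) = (F/g, G/g)`): under these hypotheses `y ∈ ℚ⟦x⟧` satisfies a
non-trivial polynomial relation `Σ_{a ≤ d, b ≤ D} c_{ab} xᵃ yᵇ = 0` over `ℚ`.
[cite: ChambertLoir2002Bourbaki, Thm. 6.2 and §6.3–6.8] -/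
theorem exists_relation_of_den_of_uniformization (y : PowerSeries ℚ) (Den : ℕ → ℕ) (K : ℝ)
    (hC : 0 < K) (hDen : ∀ n, 0 < Den n) (hDenC : ∀ n, (Den n : ℝ) ≤ K ^ n)
    (hZ : ∀ n m j, m ≤ n → ∃ z : ℤ, (Den n : ℚ) * coeff m (y ^ j) = z)
    (R : ℝ) (hCR : K < R) (g F G φf ψf : ℂ → ℂ) (hg : DifferentiableOn ℂ g (ball 0 R))
    (hF : DifferentiableOn ℂ F (ball 0 R)) (hG : DifferentiableOn ℂ G (ball 0 R))
    (hφ : AnalyticAt ℂ φf 0) (hψ : AnalyticAt ℂ ψf 0) (hFg : F =ᶠ[𝓝 0] g * φf)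
    (hGg : G =ᶠ[𝓝 0] g * ψf) (hg0 : g 0 = 1) (hφ0 : φf 0 = 0) (hφ1 : deriv φf 0 = 1)
    (hy : PowerSeries.subst 𝓣[φf] (PowerSeries.map (algebraMap ℚ ℂ) y) = 𝓣[ψf]) :
    ∃ (d D : ℕ) (c : Fin (d + 1) × Fin (D + 1) → ℚ), c ≠ 0 ∧
      ∑ ab, PowerSeries.C (c ab) * (X ^ (ab.1 : ℕ) * y ^ (ab.2 : ℕ)) = 0 := by
  by_contra H
  push Not at H
  -- radii `K < r < R` and the ratio `θ = K/r < 1`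
  set r : ℝ := (K + R) / 2 with hr_def
  have hr : 0 < r := by rw [hr_def]; linarith
  have hCr : K < r := by rw [hr_def]; linarith
  have hrR : r < R := by rw [hr_def]; linarith
  have hRpos : 0 < R := hC.trans hCR
  set θ : ℝ := K / r with hθ_def
  have hθ0 : 0 < θ := div_pos hC hr
  have hθ1 : θ < 1 := (div_lt_one hr).mpr hCr
  -- a bound `M ≥ 1` for `g, F, G` on `|z| = r`
  have hsub : sphere (0 : ℂ) r ⊆ ball 0 R := sphere_subset_closedBall.trans (closedBall_subset_ball hrR)
  obtain ⟨M, hM1, hgM, hFM, hGM⟩ : ∃ M : ℝ, 1 ≤ M ∧ (∀ z ∈ sphere (0 : ℂ) r, ‖g z‖ ≤ M) ∧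
      (∀ z ∈ sphere (0 : ℂ) r, ‖F z‖ ≤ M) ∧ ∀ z ∈ sphere (0 : ℂ) r, ‖G z‖ ≤ M := by
    obtain ⟨Bg, hBg⟩ := (isCompact_sphere (0 : ℂ) r).exists_bound_of_continuousOn
      (hg.continuousOn.mono hsub)
    obtain ⟨BF, hBF⟩ := (isCompact_sphere (0 : ℂ) r).exists_bound_of_continuousOn
      (hF.continuousOn.mono hsub)
    obtain ⟨BG, hBG⟩ := (isCompact_sphere (0 : ℂ) r).exists_bound_of_continuousOn
      (hG.continuousOn.mono hsub)
    refine ⟨max 1 (max Bg (max BF BG)), le_max_left _ _, fun z hz => (hBg z hz).trans ?_,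
      fun z hz => (hBF z hz).trans ?_, fun z hz => (hBG z hz).trans ?_⟩
    · exact (le_max_left _ _).trans (le_max_right _ _)
    · exact ((le_max_left _ _).trans (le_max_right _ _)).trans (le_max_right _ _)
    · exact ((le_max_right _ _).trans (le_max_right _ _)).trans (le_max_right _ _)
  have hM0 : 0 < M := zero_lt_one.trans_le hM1
  -- the parameter `k`
  obtain ⟨k₀, hk₀⟩ := exists_pow_lt_of_lt_one (show 0 < 1 / (4 * M ^ 2) by positivity) hθ1
  set k : ℕ := max k₀ 1 with hk_def
  have hk1 : 1 ≤ k := le_max_right _ _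
  have hθk : M ^ 2 * θ ^ (k + 1) ≤ 1 / 4 := by
    have h1 : θ ^ (k + 1) ≤ θ ^ k₀ := pow_le_pow_of_le_one hθ0.le hθ1.le (by omega)
    have h2 : M ^ 2 * θ ^ k₀ ≤ 1 / 4 := by
      rw [lt_div_iff₀ (by positivity)] at hk₀
      linarith
    exact (mul_le_mul_of_nonneg_left h1 (by positivity)).trans h2
  set d : ℕ := 2 * k with hd_def
  -- the rows
  set yC : PowerSeries ℂ := PowerSeries.map (algebraMap ℚ ℂ) y with hyC
  set q : ℕ → Fin (d + 1) × Fin (d + 1) → ℚ := fun m ab =>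
    if (ab.1 : ℕ) ≤ m then coeff (m - ab.1) (y ^ (ab.2 : ℕ)) else 0 with hq
  set w : ℕ → EuclideanSpace ℝ (Fin (d + 1) × Fin (d + 1)) := fun m =>
    WithLp.toLp 2 fun ab => (q m ab : ℝ) with hw_def
  set N : ℕ := Fintype.card (Fin (d + 1) × Fin (d + 1)) with hN_def
  have hNeq : N = (2 * k + 1) * (2 * k + 1) := by
    rw [hN_def, Fintype.card_prod, Fintype.card_fin, hd_def]
  have hNpos : 0 < N := by rw [hNeq]; positivity
  -- coefficient identities
  have hcoeffQ : ∀ (c : Fin (d + 1) × Fin (d + 1) → ℚ) (m : ℕ),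
      coeff m (∑ ab, C (c ab) * (X ^ (ab.1 : ℕ) * y ^ (ab.2 : ℕ))) = ∑ ab, c ab * q m ab := by
    intro c m
    rw [coeff_sum_C_mul_X_pow_mul_pow]
  have hcoeffC : ∀ (c : Fin (d + 1) × Fin (d + 1) → ℂ) (m : ℕ),
      coeff m (∑ ab, C (c ab) * (X ^ (ab.1 : ℕ) * yC ^ (ab.2 : ℕ))) = ∑ ab, c ab * (q m ab : ℂ) := by
    intro c m
    rw [coeff_sum_C_mul_X_pow_mul_pow]
    refine Finset.sum_congr rfl fun ab _ => ?_
    congr 1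
    simp only [hq, hyC]
    split_ifs with h
    · rw [← map_pow, coeff_map, eq_ratCast]
    · simp
  -- (i) the rows separate points
  have hsepQ : ∀ u : Fin (d + 1) × Fin (d + 1) → ℚ, (∀ m, ∑ ab, q m ab * u ab = 0) → u = 0 := by
    intro u hu
    by_contra hu0
    apply H d d u hu0
    ext m
    rw [hcoeffQ, map_zero]
    simpa only [mul_comm] using hu m
  have hw : ∀ v, (∀ m, ⟪w m, v⟫ = 0) → v = 0 := fun v hv => separating_of_rational q hsepQ v hv
  -- (ii) denominators of the rows
  have hZ' : ∀ m ab, ∃ z : ℤ, (Den m : ℝ) * w m ab = z := by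
    intro m ab
    simp only [hw_def, PiLp.toLp_apply, hq]
    by_cases h : (ab.1 : ℕ) ≤ m
    · obtain ⟨z, hz⟩ := hZ m (m - ab.1) ab.2 (Nat.sub_le _ _)
      refine ⟨z, ?_⟩
      rw [if_pos h]
      exact_mod_cast hz
    · exact ⟨0, by rw [if_neg h]; simp⟩
  -- (iii) the Schwarz bound on the jump functionals
  set β : ℕ → ℝ := fun m => Real.sqrt N * M ^ (d + d) / r ^ m with hβ_def
  have hβ : ∀ m v, (∀ m' < m, ⟪w m', v⟫ = 0) → |⟪w m, v⟫| ≤ β m * ‖v‖ := by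
    intro m v hv
    set P : Fin (d + 1) × Fin (d + 1) → ℂ := fun ab => ((v ab : ℝ) : ℂ) with hP
    have hSP : ∀ m', coeff m' (∑ ab, C (P ab) * (X ^ (ab.1 : ℕ) * yC ^ (ab.2 : ℕ))) =
        ((⟪w m', v⟫ : ℝ) : ℂ) := by
      intro m'
      rw [hcoeffC, hw_def, inner_toLp_ratCast]
      push_cast
      refine Finset.sum_congr rfl fun ab _ => ?_
      rw [hP, mul_comm]
    have hP0 : ∀ m' < m, coeff m' (∑ ab, C (P ab) * (X ^ (ab.1 : ℕ) * yC ^ (ab.2 : ℕ))) = 0 := by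
      intro m' hm'
      rw [hSP, hv m' hm']
      simp
    have hest := norm_coeff_le_of_coeff_lt_eq_zero hRpos hr hrR hM1 hg hF hG hφ hψ hFg hGg hg0 hφ0
      hφ1 hgM hFM hGM (y := yC) hy P hP0
    rw [hSP, Complex.norm_real, Real.norm_eq_abs] at hest
    have hsum : ∑ ab, ‖P ab‖ ≤ Real.sqrt N * ‖v‖ := by
      have h1 : ∑ ab, ‖P ab‖ = ∑ ab, |v ab| := Finset.sum_congr rfl fun ab _ => by
        rw [hP, Complex.norm_real, Real.norm_eq_abs]
      rw [h1, hN_def]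
      exact sum_abs_le_sqrt_card_mul_norm v
    calc |⟪w m, v⟫| ≤ (∑ ab, ‖P ab‖) * M ^ (d + d) / r ^ m := hest
      _ ≤ Real.sqrt N * ‖v‖ * M ^ (d + d) / r ^ m := by gcongr
      _ = β m * ‖v‖ := by rw [hβ_def]; ring
  -- (iv) the determinant inequality
  obtain ⟨n, hn, hone⟩ := exists_strictMono_one_le_prod w hw β hβ Den hDen hZ'
  -- (v) bounding its right-hand side
  set S : ℕ := ∑ j, n j with hS_def
  set A : ℝ := Real.sqrt N * M ^ (d + d) with hA_def
  have hA0 : 0 ≤ A := by positivity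
  have hprodDen : (∏ j, (Den (n j) : ℝ)) ≤ K ^ S := by
    rw [hS_def, ← Finset.prod_pow_eq_pow_sum]
    exact Finset.prod_le_prod (fun j _ => Nat.cast_nonneg _) fun j _ => hDenC (n j)
  have hprodβ : ∏ j, β (n j) = A ^ N * (r ^ S)⁻¹ := by
    have : ∀ j, β (n j) = A * (r ^ n j)⁻¹ := fun j => by
      simp only [hβ_def, div_eq_mul_inv]
    simp_rw [this]
    rw [Finset.prod_mul_distrib, Finset.prod_const, Finset.card_univ, Fintype.card_fin,
      Finset.prod_inv_distrib, Finset.prod_pow_eq_pow_sum]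
  have hRHS : (∏ j, (Den (n j) : ℝ)) * ∏ j, β (n j) ≤ A ^ N * θ ^ S := by
    have hθS' : θ ^ S = K ^ S * (r ^ S)⁻¹ := by rw [hθ_def, div_pow, div_eq_mul_inv]
    rw [hprodβ, hθS']
    have h0 : 0 ≤ A ^ N * (r ^ S)⁻¹ := by positivity
    calc (∏ j, (Den (n j) : ℝ)) * (A ^ N * (r ^ S)⁻¹) ≤ K ^ S * (A ^ N * (r ^ S)⁻¹) :=
          mul_le_mul_of_nonneg_right hprodDen h0
      _ = A ^ N * (K ^ S * (r ^ S)⁻¹) := by ring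
  -- `Σ nⱼ ≥ N(N-1)/2 = N · 2k(k+1)`
  have hSge : N * (2 * k * (k + 1)) ≤ S := by
    have h1 := sum_fin_le_sum_of_strictMono hn
    have h2 : 2 * ∑ j : Fin N, (j : ℕ) = N * (N - 1) := two_mul_sum_fin_val N
    have h3 : N - 1 = 2 * (2 * k * (k + 1)) := by
      rw [hNeq]
      have : (2 * k + 1) * (2 * k + 1) = 2 * (2 * k * (k + 1)) + 1 := by ring
      omega
    rw [h3] at h2
    have h4 : ∑ j : Fin N, (j : ℕ) = N * (2 * k * (k + 1)) := by
      have : 2 * ∑ j : Fin N, (j : ℕ) = 2 * (N * (2 * k * (k + 1))) := by rw [h2]; ring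
      omega
    rw [hS_def, hN_def] at *
    omega
  have hθS : θ ^ S ≤ (θ ^ (2 * k * (k + 1))) ^ N := by
    rw [← pow_mul']
    exact pow_le_pow_of_le_one hθ0.le hθ1.le hSge
  -- the base `b = (2k+1)·(M²θ^{k+1})^{2k}`
  have hsqrtN : Real.sqrt N = 2 * k + 1 := by
    rw [hNeq]
    push_cast
    exact Real.sqrt_mul_self (by positivity)
  have hbase : A * θ ^ (2 * k * (k + 1)) = (2 * k + 1) * (M ^ 2 * θ ^ (k + 1)) ^ (2 * k) := by
    rw [hA_def, hsqrtN, hd_def, mul_pow, ← pow_mul, ← pow_mul]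
    ring_nf
  have hb1 : (2 * k + 1 : ℝ) * (M ^ 2 * θ ^ (k + 1)) ^ (2 * k) < 1 := by
    have h1 : (M ^ 2 * θ ^ (k + 1)) ^ (2 * k) ≤ (1 / 4) ^ (2 * k) :=
      pow_le_pow_left₀ (by positivity) hθk _
    have h2 : ((1 : ℝ) / 4) ^ (2 * k) = 1 / 16 ^ k := by
      rw [pow_mul, show ((1 : ℝ) / 4) ^ 2 = 1 / 16 by norm_num, div_pow, one_pow]
    have h3 : (2 * k + 1 : ℝ) < 16 ^ k := by exact_mod_cast two_mul_add_one_lt_sixteen_pow hk1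
    have h4 : (0 : ℝ) < 16 ^ k := by positivity
    calc (2 * k + 1 : ℝ) * (M ^ 2 * θ ^ (k + 1)) ^ (2 * k)
        ≤ (2 * k + 1) * (1 / 16 ^ k) := by
          rw [← h2]; exact mul_le_mul_of_nonneg_left h1 (by positivity)
      _ = (2 * k + 1) / 16 ^ k := by ring
      _ < 1 := (div_lt_one h4).mpr h3
  have hb0 : 0 ≤ (2 * k + 1 : ℝ) * (M ^ 2 * θ ^ (k + 1)) ^ (2 * k) := by positivity
  -- conclusion
  have hfinal : (∏ j, (Den (n j) : ℝ)) * ∏ j, β (n j) < 1 := by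
    calc (∏ j, (Den (n j) : ℝ)) * ∏ j, β (n j) ≤ A ^ N * θ ^ S := hRHS
      _ ≤ A ^ N * (θ ^ (2 * k * (k + 1))) ^ N := mul_le_mul_of_nonneg_left hθS (by positivity)
      _ = (A * θ ^ (2 * k * (k + 1))) ^ N := by rw [← mul_pow]
      _ = ((2 * k + 1) * (M ^ 2 * θ ^ (k + 1)) ^ (2 * k)) ^ N := by rw [hbase]
      _ ≤ (2 * k + 1) * (M ^ 2 * θ ^ (k + 1)) ^ (2 * k) := pow_le_of_le_one hb0 hb1.le hNpos.ne'
      _ < 1 := hb1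
  linarith

end Literature.NumberTheory.Transcendental.AndreCriterion

end
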